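import Mathlib
import Literature.Probability.Divergences.RenyiDivergence
import HarnessLib

/-!
# Rare events stay rare under a Rényi perturbation (stub S2)

Helper file (`--supports stmt-AtomisticToContinuum-15145`) proving the registered stub
`stub_measureLeOfHellinger` of the lead's skeleton for the crux
`Summit.AtomisticToContinuum.HydrodynamicLimit.Theses.TwoClocks.ClampedEntropyClock`
(line `IdeatorTwoSketch`): for finite measures `μ ≪ ν`, conjugate exponents `1 < p`,
`p⁻¹ + q⁻¹ = 1`, and a measurable set `A`,
`μ A ≤ ν(A)^{1/p} · (hellingerIntegral q μ ν)^{1/q}`.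

Proof summary. `μ A = ∫⁻ x in A, dμ/dν dν` (`Measure.setLIntegral_rnDeriv`), the set integral is
`∫⁻ 𝟙_A · dμ/dν dν`, Hölder (`ENNReal.lintegral_mul_le_Lp_mul_Lq`) bounds it by
`(∫⁻ 𝟙_A^p dν)^{1/p} (∫⁻ (dμ/dν)^q dν)^{1/q}`, and `𝟙_A^p = 𝟙_A` (`p > 0`), `∫⁻ 𝟙_A dν = ν A`,
`∫⁻ (dμ/dν)^q dν = hellingerIntegral q μ ν` for `μ ≪ ν` (`hellingerIntegral_of_ac`).
-/

noncomputable section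

open MeasureTheory Set
open scoped ENNReal

namespace Summit.AtomisticToContinuum.HydrodynamicLimit.Theorems.QuenchedCellClock

open Literature.Probability.Divergences

/-- Hölder against an indicator: for conjugate exponents `p, q`, a measurable set `A` and an
a.e.-measurable `g : Ω → ℝ≥0∞`, `∫_A g dν ≤ ν(A)^{1/p} · (∫ g^q dν)^{1/q}`. [folklore] -/
theorem setLIntegral_le_measure_rpow_mul_lintegral_rpow {Ω : Type*} [MeasurableSpace Ω]
    (ν : Measure Ω) {p q : ℝ} (hpq : p.HolderConjugate q) {A : Set Ω} (hA : MeasurableSet A)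
    {g : Ω → ℝ≥0∞} (hg : AEMeasurable g ν) :
    ∫⁻ x in A, g x ∂ν ≤ (ν A) ^ p⁻¹ * (∫⁻ x, g x ^ q ∂ν) ^ q⁻¹ := by
  have hf : AEMeasurable (A.indicator (1 : Ω → ℝ≥0∞)) ν :=
    (measurable_one.indicator hA).aemeasurable
  have hprod : (A.indicator (1 : Ω → ℝ≥0∞) * g) = A.indicator g := by
    funext x
    by_cases hx : x ∈ A <;> simp [hx]
  have hpow : (fun x => (A.indicator (1 : Ω → ℝ≥0∞) x) ^ p) = A.indicator 1 := by
    funext x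
    by_cases hx : x ∈ A
    · simp [hx]
    · simp [hx, hpq.pos]
  calc ∫⁻ x in A, g x ∂ν = ∫⁻ x, (A.indicator (1 : Ω → ℝ≥0∞) * g) x ∂ν := by
        rw [hprod, lintegral_indicator hA]
    _ ≤ (∫⁻ x, (A.indicator (1 : Ω → ℝ≥0∞) x) ^ p ∂ν) ^ (1 / p) *
          (∫⁻ x, g x ^ q ∂ν) ^ (1 / q) :=
        ENNReal.lintegral_mul_le_Lp_mul_Lq ν hpq hf hg
    _ = (ν A) ^ p⁻¹ * (∫⁻ x, g x ^ q ∂ν) ^ q⁻¹ := by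
        rw [hpow, lintegral_indicator_one hA, one_div, one_div]

/-- **Stub S2 — super-exponentially rare events stay rare under an `e^{O(N)}`-Rényi perturbation**
(Hölder on `μ A = ∫_A dμ/dν dν`): for finite measures `μ ≪ ν`, conjugate exponents `1 < p`,
`p⁻¹ + q⁻¹ = 1`, and a measurable `A`, `μ A ≤ ν(A)^{1/p} · (∫ (dμ/dν)^q dν)^{1/q}`.
[cite: VanervenHarremoes2014, §II-A] -/
theorem stub_measureLeOfHellinger {Ω : Type*} [MeasurableSpace Ω] (μ ν : Measure Ω)
    [IsFiniteMeasure μ] [IsFiniteMeasure ν] (hac : μ ≪ ν) {p q : ℝ} (hp : 1 < p)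
    (hpq : p⁻¹ + q⁻¹ = 1) (A : Set Ω) (hA : MeasurableSet A) :
    μ A ≤ (ν A) ^ p⁻¹ * (hellingerIntegral q μ ν) ^ q⁻¹ := by
  rw [hellingerIntegral_of_ac hac, ← Measure.setLIntegral_rnDeriv hac A]
  exact setLIntegral_le_measure_rpow_mul_lintegral_rpow ν (Real.holderConjugate_iff.mpr ⟨hp, hpq⟩)
    hA (Measure.measurable_rnDeriv μ ν).aemeasurable

end Summit.AtomisticToContinuum.HydrodynamicLimit.Theorems.QuenchedCellClock
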